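import Literature.Analysis.Complex.UnitDiscAutNormalizer
import Literature.Analysis.Complex.CircleHomomorphisms
import Mathlib.Analysis.Complex.Basic
import HarnessLib

/-!
# Homeomorphisms of the disc normalising `Aut(𝔻)`, II: they are the RC-holomorphic automorphisms

Topic `Literature/Analysis/Complex`.  Conclusion of the argument begun in
`UnitDiscAutNormalizer.lean`: a homeomorphism `h` of the open unit disc (inverse `k`, both given
as total functions `ℂ → ℂ`) such that `h ∘ f ∘ h⁻¹` is a holomorphic automorphism of the disc for
every holomorphic automorphism `f` is itself a holomorphic automorphism `z ↦ c·φ_a(z)` or an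
anti-holomorphic one `z ↦ c·φ_a(z̄)` (`‖c‖ = 1`, `‖a‖ < 1`):

* `Literature.Analysis.Complex.exists_eq_discRot_or_conj_of_normalizes`.

This is the statement "the normaliser of `Aut(𝔻) ≅ PSL₂(ℝ)` in `Homeo(𝔻)` is
`Aut^{RC-hol}(𝔻) ≅ PGL₂(ℝ)`", the group-theoretic heart of S. Mochizuki, *Topics in absolute
anabelian geometry III*, Prop. 2.2 (i)/(ii) (there deduced from Cartan's theorem on continuous
automorphisms of `SL₂(ℝ)/{±1}`; here from the elementary hyperbolic-geometry argument of part I).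
Steps: move `h 0` to `0` by a Möbius map; the conjugates of the rotations about `0` are rotations,
giving a continuous injective endomorphism `β` of the circle group, hence `β = id` or complex
conjugation (the tree's `circle_hom_eq_mul_or_mul_conj`); after composing with `z ↦ z̄` in the
second case, part I applies.

## Mathlib / tree

USED: `UnitDiscAutomorphisms`, `UnitDiscAutNormalizer`, `CircleHomomorphisms`
(`circle_hom_eq_mul_or_mul_conj`).  Proof-only file.
-/

noncomputable section

open Set Filter Metric Function
open _root_.Complex
open scoped ComplexConjugate Topology

namespace Literature.Analysis.Complex

/-! ### Complex conjugation and `Aut(𝔻)` -/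

/-- `conj (φ_a z) = φ_{ā} (z̄)`. [cite: Conway1978, Ch. VI Prop. 2.2] -/
theorem conj_discMobius (a z : ℂ) : conj (discMobius a z) = discMobius (conj a) (conj z) := by
  simp only [discMobius, map_div₀, map_sub, map_mul, map_one, conj_conj]

/-- Complex conjugation maps the disc to the disc. [folklore] -/
private theorem conj_mem_ball {z : ℂ} (hz : z ∈ ball (0 : ℂ) 1) : conj z ∈ ball (0 : ℂ) 1 := by
  rwa [mem_ball_zero_iff, norm_conj, ← mem_ball_zero_iff]

/-- `Aut(𝔻)` is normalised by complex conjugation: `z ↦ conj (f (conj z))` is an automorphism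
for every automorphism `f`. [cite: Conway1978, Ch. VI Thm. 2.5] -/
theorem IsDiscAut.conj_conj {f : ℂ → ℂ} (hf : IsDiscAut f) : IsDiscAut fun z => conj (f (conj z)) := by
  obtain ⟨c, a, hc, ha, -, hfe⟩ := hf.exists_eq_discRot
  have hc' : ‖conj c‖ = 1 := by rw [norm_conj, hc]
  have ha' : ‖conj a‖ < 1 := by rw [norm_conj]; exact ha
  refine (isDiscAut_discRot hc' ha').congr fun z hz => ?_
  rw [hfe (conj_mem_ball hz), discRot, discRot, map_mul, conj_discMobius, Complex.conj_conj]

/-! ### Reduction lemmas -/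

section Reduction

variable {h k : ℂ → ℂ}

/-- The conjugates `h ∘ (u · ) ∘ h⁻¹` of the rotations are rotations: for a homeomorphism `h` of the
disc with `h 0 = 0` normalising `Aut(𝔻)` there is `β : ℂ → ℂ` (explicitly
`β u = 2 h (u · h⁻¹(1/2))`) with `h (u w) = β(u) · h(w)` on the disc and `‖β u‖ = 1`, for every
`‖u‖ = 1`. [cite: MochizukiAbsTopIII2015, Proposition 2.2 (i) p.52] -/
theorem apply_mul_eq_of_normalizes (hm : MapsTo h (ball 0 1) (ball 0 1))
    (hkh : ∀ z ∈ ball (0 : ℂ) 1, k (h z) = z) (hnorm : ∀ f, IsDiscAut f → IsDiscAut (h ∘ f ∘ k))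
    (h0 : h 0 = 0) {u : ℂ} (hu : ‖u‖ = 1) :
    ‖2 * h (u * k (1 / 2))‖ = 1 ∧
      ∀ w ∈ ball (0 : ℂ) 1, h (u * w) = (2 * h (u * k (1 / 2))) * h w := by
  have hk0 : k 0 = 0 := by simpa [h0] using hkh 0 (mem_ball_self one_pos)
  have hg := hnorm _ (isDiscAut_mul hu)
  have hg0 : (h ∘ (fun z => u * z) ∘ k) 0 = 0 := by simp [hk0, h0]
  obtain ⟨c, hc, hgc⟩ := hg.exists_eq_mul_of_map_zero hg0
  have hhalf : (1 / 2 : ℂ) ∈ ball (0 : ℂ) 1 := by rw [mem_ball_zero_iff]; norm_num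
  have hcv : c = 2 * h (u * k (1 / 2)) := by
    have e := hgc hhalf
    simp only [comp_apply] at e
    rw [e]; ring
  refine ⟨by rw [← hcv, hc], fun w hw => ?_⟩
  have e := hgc (hm hw)
  simp only [comp_apply, hkh w hw] at e
  rw [e, hcv]

/-- The disc `ℂ`-conjugate `z ↦ conj (h z)` of a homeomorphism normalising `Aut(𝔻)` (with
inverse `z ↦ k (conj z)`) again normalises `Aut(𝔻)`. [cite: MochizukiAbsTopIII2015, Proposition 2.2 (i) p.52] -/
theorem normalizes_conj (hnorm : ∀ f, IsDiscAut f → IsDiscAut (h ∘ f ∘ k)) (f : ℂ → ℂ)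
    (hf : IsDiscAut f) :
    IsDiscAut ((fun z => conj (h z)) ∘ f ∘ fun z => k (conj z)) :=
  (hnorm f hf).conj_conj

end Reduction

/-! ### The normaliser of `Aut(𝔻)` in `Homeo(𝔻)` -/

section Main

variable {h k : ℂ → ℂ}

/-- **Normalising homeomorphisms fixing the origin** are rotations or reflections: if `h 0 = 0`
then `h z = c z` on `𝔻` or `h z = c z̄` on `𝔻`, for a constant `‖c‖ = 1`.
[cite: MochizukiAbsTopIII2015, Proposition 2.2 (i) p.52] -/
theorem exists_eq_mul_or_mul_conj_of_normalizes (hc : ContinuousOn h (ball 0 1))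
    (hm : MapsTo h (ball 0 1) (ball 0 1)) (km : MapsTo k (ball 0 1) (ball 0 1))
    (hkh : ∀ z ∈ ball (0 : ℂ) 1, k (h z) = z) (hhk : ∀ z ∈ ball (0 : ℂ) 1, h (k z) = z)
    (hnorm : ∀ f, IsDiscAut f → IsDiscAut (h ∘ f ∘ k)) (h0 : h 0 = 0) :
    ∃ c : ℂ, ‖c‖ = 1 ∧
      (EqOn h (fun z => c * z) (ball 0 1) ∨ EqOn h (fun z => c * conj z) (ball 0 1)) := by
  -- the circle endomorphism `β`
  set w₀ : ℂ := k (1 / 2) with hw₀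
  set β : ℂ → ℂ := fun u => 2 * h (u * w₀) with hβ
  have hhalf : (1 / 2 : ℂ) ∈ ball (0 : ℂ) 1 := by rw [mem_ball_zero_iff]; norm_num
  have hw₀m : w₀ ∈ ball (0 : ℂ) 1 := km hhalf
  have hw₀n : ‖w₀‖ < 1 := mem_ball_zero_iff.1 hw₀m
  have hhw₀ : h w₀ = 1 / 2 := hhk _ hhalf
  have hw₀0 : w₀ ≠ 0 := by
    intro h'
    have : h w₀ = 0 := by rw [h', h0]
    rw [hhw₀] at this
    norm_num at this
  have hβ1 : β 1 = 1 := by simp only [hβ, one_mul, hhw₀]; norm_num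
  have hrot : ∀ u : ℂ, ‖u‖ = 1 → ‖β u‖ = 1 ∧ ∀ w ∈ ball (0 : ℂ) 1, h (u * w) = β u * h w :=
    fun u hu => apply_mul_eq_of_normalizes hm hkh hnorm h0 hu
  have hsph : ∀ u : ℂ, u ∈ sphere (0 : ℂ) 1 ↔ ‖u‖ = 1 := fun u => mem_sphere_zero_iff_norm
  have humem : ∀ {u : ℂ}, ‖u‖ = 1 → u * w₀ ∈ ball (0 : ℂ) 1 := by
    intro u hu
    rw [mem_ball_zero_iff, norm_mul, hu, one_mul]; exact hw₀n
  -- hypotheses of the circle rigidity lemma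
  have hβc : ContinuousOn β (sphere 0 1) := by
    refine ContinuousOn.mul continuousOn_const ?_
    refine hc.comp (Continuous.continuousOn (by fun_prop)) fun u hu => humem ((hsph u).1 hu)
  have hβm : MapsTo β (sphere 0 1) (sphere 0 1) := fun u hu =>
    (hsph _).2 (hrot u ((hsph u).1 hu)).1
  have hβi : InjOn β (sphere 0 1) := by
    intro u hu v hv huv
    have hu1 := (hsph u).1 hu
    have hv1 := (hsph v).1 hv
    have e : h (u * w₀) = h (v * w₀) := by
      have := huv; simp only [hβ] at this
      exact mul_left_cancel₀ two_ne_zero this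
    have e2 : u * w₀ = v * w₀ := by
      have := congrArg k e
      rwa [hkh _ (humem hu1), hkh _ (humem hv1)] at this
    exact mul_right_cancel₀ hw₀0 e2
  have hβhom : ∀ a ∈ sphere (0 : ℂ) 1, ∀ b ∈ sphere (0 : ℂ) 1, β (a * b) * β 1 = β a * β b := by
    intro a ha b hb
    have ha1 := (hsph a).1 ha
    have hb1 := (hsph b).1 hb
    have hab1 : ‖a * b‖ = 1 := by rw [norm_mul, ha1, hb1, one_mul]
    rw [hβ1, mul_one]
    -- evaluate `h (a b w₀)` in two ways
    have e1 := (hrot _ hab1).2 w₀ hw₀m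
    have e2 := (hrot _ ha1).2 _ (humem hb1)
    have e3 := (hrot _ hb1).2 w₀ hw₀m
    rw [mul_assoc, e2, e3, ← mul_assoc] at e1
    have hne : h w₀ ≠ 0 := by rw [hhw₀]; norm_num
    exact mul_right_cancel₀ hne e1.symm
  rcases circle_hom_eq_mul_or_mul_conj hβc hβm hβi hβhom with hid | hconj
  · -- `β = id`: part I applies to `h` itself
    have hrot' : ∀ u : ℂ, ‖u‖ = 1 → ∀ w ∈ ball (0 : ℂ) 1, h (u * w) = u * h w := by
      intro u hu w hw
      rw [(hrot u hu).2 w hw, hid u ((hsph u).2 hu), hβ1, one_mul]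
    obtain ⟨c, hcn, hce⟩ := eqOn_mul_of_normalizes_of_rot hm km hkh hhk hnorm h0 hrot'
    exact ⟨c, hcn, Or.inl hce⟩
  · -- `β = conj`: part I applies to `z ↦ conj (h z)`
    set h' : ℂ → ℂ := fun z => conj (h z) with hh'
    set k' : ℂ → ℂ := fun z => k (conj z) with hk'
    have hm' : MapsTo h' (ball 0 1) (ball 0 1) := fun z hz => conj_mem_ball (hm hz)
    have km' : MapsTo k' (ball 0 1) (ball 0 1) := fun z hz => km (conj_mem_ball hz)
    have hkh' : ∀ z ∈ ball (0 : ℂ) 1, k' (h' z) = z := by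
      intro z hz; simp only [hh', hk', conj_conj, hkh z hz]
    have hhk' : ∀ z ∈ ball (0 : ℂ) 1, h' (k' z) = z := by
      intro z hz; simp only [hh', hk', hhk _ (conj_mem_ball hz), conj_conj]
    have hnorm' : ∀ f, IsDiscAut f → IsDiscAut (h' ∘ f ∘ k') := normalizes_conj hnorm
    have h0' : h' 0 = 0 := by simp [hh', h0]
    have hrot' : ∀ u : ℂ, ‖u‖ = 1 → ∀ w ∈ ball (0 : ℂ) 1, h' (u * w) = u * h' w := by
      intro u hu w hw
      simp only [hh']
      rw [(hrot u hu).2 w hw, hconj u ((hsph u).2 hu), hβ1, one_mul, map_mul, conj_conj]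
    obtain ⟨c, hcn, hce⟩ := eqOn_mul_of_normalizes_of_rot hm' km' hkh' hhk' hnorm' h0' hrot'
    refine ⟨conj c, by rw [norm_conj, hcn], Or.inr fun z hz => ?_⟩
    have e := hce hz
    simp only [hh'] at e
    rw [← conj_conj (h z), e, map_mul]

/-- `φ_{-b} (c z) = c · φ_{-b c̄} (z)` for `‖c‖ = 1`: a Möbius map followed by the translation
`φ_{-b}` is again of the form `discRot`. [cite: Conway1978, Ch. VI Thm. 2.5] -/
theorem discMobius_neg_mul {c : ℂ} (hc : ‖c‖ = 1) (b z : ℂ) :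
    discMobius (-b) (c * z) = discRot c (-(b * conj c)) z := by
  have hcc : c * conj c = 1 := by
    rw [mul_conj', ← ofReal_pow, hc]; norm_num
  have hnum : c * (z + b * conj c) = c * z + b := by linear_combination b * hcc
  rw [discRot, discMobius_apply, discMobius_apply]
  simp only [map_neg, map_mul, conj_conj, neg_mul, sub_neg_eq_add]
  rw [mul_div_assoc', hnum]
  congr 1
  ring

/-- **The normaliser of `Aut(𝔻)` in `Homeo(𝔻)` is the group of RC-holomorphic automorphisms.**
Let `h` be a homeomorphism of the open unit disc — `h` continuous on `𝔻`, mapping `𝔻` into `𝔻`,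
with a two-sided inverse `k` on `𝔻` mapping `𝔻` into `𝔻` — such that `h ∘ f ∘ k` is a
holomorphic automorphism of the disc for every holomorphic automorphism `f`.  Then there are
`‖c‖ = 1`, `‖a‖ < 1` with `h z = c·φ_a(z)` on `𝔻` (so `h ∈ Aut(𝔻)`) or `h z = c·φ_a(z̄)` on `𝔻`
(`h` is an anti-holomorphic automorphism).  This is the group-theoretic core of
[AbsTopIII] Prop. 2.2 (i) (every isomorphism of Aut-holomorphic discs is RC-holomorphic), proved
here without Lie theory. [cite: MochizukiAbsTopIII2015, Proposition 2.2 (i) p.52] -/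
theorem exists_eq_discRot_or_conj_of_normalizes (hc : ContinuousOn h (ball 0 1))
    (hm : MapsTo h (ball 0 1) (ball 0 1)) (km : MapsTo k (ball 0 1) (ball 0 1))
    (hkh : ∀ z ∈ ball (0 : ℂ) 1, k (h z) = z) (hhk : ∀ z ∈ ball (0 : ℂ) 1, h (k z) = z)
    (hnorm : ∀ f, IsDiscAut f → IsDiscAut (h ∘ f ∘ k)) :
    ∃ c a : ℂ, ‖c‖ = 1 ∧ ‖a‖ < 1 ∧
      (EqOn h (discRot c a) (ball 0 1) ∨ EqOn h (fun z => discRot c a (conj z)) (ball 0 1)) := by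
  -- move `b = h 0` to the origin
  set b := h 0 with hb
  have hbn : ‖b‖ < 1 := mem_ball_zero_iff.1 (hm (mem_ball_self one_pos))
  have hbn' : ‖-b‖ < 1 := by rwa [norm_neg]
  set h₁ : ℂ → ℂ := discMobius b ∘ h with hh₁
  set k₁ : ℂ → ℂ := k ∘ discMobius (-b) with hk₁
  have hφm := mapsTo_discMobius hbn
  have hφm' := mapsTo_discMobius hbn'
  have hc₁ : ContinuousOn h₁ (ball 0 1) :=
    (differentiableOn_discMobius hbn).continuousOn.comp hc hm
  have hm₁ : MapsTo h₁ (ball 0 1) (ball 0 1) := hφm.comp hm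
  have km₁ : MapsTo k₁ (ball 0 1) (ball 0 1) := km.comp hφm'
  have hkh₁ : ∀ z ∈ ball (0 : ℂ) 1, k₁ (h₁ z) = z := by
    intro z hz
    simp only [hh₁, hk₁, comp_apply]
    rw [discMobius_neg_discMobius hbn (mem_ball_zero_iff.1 (hm hz)).le, hkh z hz]
  have hhk₁ : ∀ z ∈ ball (0 : ℂ) 1, h₁ (k₁ z) = z := by
    intro z hz
    simp only [hh₁, hk₁, comp_apply]
    rw [hhk _ (hφm' hz)]
    simpa using discMobius_neg_discMobius hbn' (mem_ball_zero_iff.1 hz).le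
  have hnorm₁ : ∀ f, IsDiscAut f → IsDiscAut (h₁ ∘ f ∘ k₁) := by
    intro f hf
    have := (isDiscAut_discMobius hbn).comp ((hnorm f hf).comp (isDiscAut_discMobius hbn'))
    exact this
  have h₁0 : h₁ 0 = 0 := by simp [hh₁, hb]
  obtain ⟨c, hcn, hce⟩ := exists_eq_mul_or_mul_conj_of_normalizes hc₁ hm₁ km₁ hkh₁ hhk₁ hnorm₁ h₁0
  have han : ‖-(b * conj c)‖ < 1 := by rw [norm_neg, norm_mul, norm_conj, hcn, mul_one]; exact hbn
  -- undo the translation: `h = φ_{-b} ∘ h₁` on the disc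
  have hundo : ∀ z ∈ ball (0 : ℂ) 1, h z = discMobius (-b) (h₁ z) := by
    intro z hz
    simp only [hh₁, comp_apply]
    rw [discMobius_neg_discMobius hbn (mem_ball_zero_iff.1 (hm hz)).le]
  refine ⟨c, -(b * conj c), hcn, han, ?_⟩
  rcases hce with hce | hce
  · left
    intro z hz
    rw [hundo z hz, hce hz, discMobius_neg_mul hcn]
  · right
    intro z hz
    rw [hundo z hz, hce hz, discMobius_neg_mul hcn]

end Main

end Literature.Analysis.Complex
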